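import Mathlib.Analysis.InnerProductSpace.Projection.Reflection
import Literature.MathematicalPhysics.QuantumLattice.OSPolyCluster
import Literature.MathematicalPhysics.QuantumLattice.SchwingerOSPositivity
import Literature.MathematicalPhysics.QuantumLattice.SchwartzTensorDensityProofs
import HarnessLib

/-!
# The cluster property E4 for the Schwinger functions of an OS measure

Trunk **T-AQFT** (proofs file for the E4 bridge of
`Literature.MathematicalPhysics.QuantumLattice.SchwingerOSAxioms`), families `constructive-qft`,
`crit-ising`.

This file **discharges the named fact** `Literature.MathematicalPhysics.QuantumLattice.IsSchwingerFamilyOf.hasClusterProperty`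
(`IsSchwingerFamilyOf.hasClusterProperty_holds`): if `μ` satisfies the measure-form
Osterwalder–Schrader axioms OS0–OS4 (`IsOSMeasure`) with jointly continuous moments and `𝔖` is
its Schwinger family, then `𝔖` has the cluster property (E4) of OS 1973 §3,
`𝔖ₙ₊ₘ(Θf* ⊗ g_{(ta,1)}) → 𝔖ₙ(Θf*) 𝔖ₘ(g)` as `t → ∞` for spatial `a ≠ 0`.

## Proof (Glimm–Jaffe Thm 19.7.1; OS 1973 §3 Remark 2)

* **A.** OS's involution `f ↦ f*` (`osStar`, OS 1973 §2 p. 87) and kinematics of `Θ`, translations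
  and rotations against `F ⊗ G`.
* **B–C.** For the Schwinger family of a measure, `𝔖ₙ₊ₘ(F* ⊗ G)` is an `L²(dμ)` inner product on
  the span of tensor products (`apply_osStar_appendTensor_polyTensor`, GJ (6.1.15)), whence the
  bound `|𝔖ₙ₊ₘ(F* ⊗ G)| ≤ N(F)^{1/2} N(G)^{1/2}`, `N(F) = Re 𝔖₂ₙ(F* ⊗ F) ≥ 0`, for ALL `F, G` by
  density of tensor products (`denseSpan_tensorProducts_holds`) and continuity; `N` is invariant
  under translations and rotations (E1).
* **D.** Time clustering `𝔖ₙ₊ₘ(A ⊗ B(· - s e₀)) → 𝔖ₙ(A) 𝔖ₘ(B)` (`IsOSMeasure.timeClusters`) for all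
  `A, B`: (1) for `A = Θ(⊗fᵢ)*`, `B = ⊗gⱼ` with positive-time real factors the correlation is the
  OS form `b(δ_f, T_s δ_g)` of `OSPolyCluster`, which converges by GJ Thm 19.7.1
  (`tendsto_polyForm_polyShift`: contraction semigroup + OS4); (1') finite combinations by
  sesquilinearity; (2) positive-time `F, G` by the density of positive-time tensor products
  (`IsPositiveTimeMulti.mem_closure_span_positiveTensorProducts_holds`) with the error controlled
  uniformly in `s` by the `L²` bound (a Moore–Osgood exchange of limits,
  `tendsto_of_uniform_approx`); (3) arbitrary `A, B` through compactly supported approximants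
  (`exists_hasCompactSupport_tendsto`) shifted backward/forward in time by E1 so as to become
  `Θ F*` and `G` with `F, G` positive-time (OS 1973 Remark 2, p. 89: the covariant form (E4')).
* **E.** A nonzero spatial `a` is moved to `‖a‖ e₀` by the reflection
  `Submodule.reflection (ℝ ∙ (a - ‖a‖e₀))ᗮ ∈ O(d)`; E1 (full `O(d)` covariance, the tree's
  convention) turns E4 into time clustering at times `t‖a‖ → ∞`.

## Sources

* K. Osterwalder, R. Schrader, *Axioms for Euclidean Green's functions*, Comm. Math. Phys. 31
  (1973) 83–112: §2 p. 87 (`f*`, `Θ`), §3 (E4) and Remark 2 p. 89 ((E4) ⇔ (E4') by (E1)).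
  [OsterwalderSchraderCMP1973]
* J. Glimm, A. Jaffe, *Quantum Physics: a functional integral point of view* (2nd ed. 1987),
  §6.1 ((6.1.15), Prop. 6.1.4, Thm 6.1.5: OS4 ⇔ W4) and Thm 19.7.1 (pp. 314–315).
  [GlimmJaffeQP1987]

## Mathlib

Used: `Submodule.reflection`, `Submodule.reflection_sub` (Householder reflection exchanging two
vectors of equal norm), `Finsupp.linearCombination` / `Finsupp.range_linearCombination`
(presentation of spans), `Submodule.span_induction₂`, `mem_closure_iff_seq_limit` (Fréchet
spaces are sequential), `isBounded_iff_forall_norm_le`, `Filter.Tendsto.atTop_mul_const`.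
Absent at the pin: any cluster/E4 statement, tensor products of Schwartz functions (the tree's
`SchwartzMap.appendTensor` is used).
-/

open scoped SchwartzMap ComplexConjugate ENNReal
open MeasureTheory Filter Topology Complex Set

noncomputable section

namespace Literature.MathematicalPhysics.QuantumLattice

/-! ### A. The involution `f ↦ f*` and kinematic identities -/

section OSStar

variable {E : Type*} [NormedAddCommGroup E] [NormedSpace ℝ E]
variable {n m : ℕ}

/-- Osterwalder–Schrader's involution `f ↦ f*` on `n`-point test functions,
`f*(x₁, …, xₙ) = conj f(xₙ, …, x₁)` (OS 1973 §2, p. 87); `Θf* = osAdjoint f`. Built as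
`starTest ∘ permTest Fin.revPerm`. [cite: OsterwalderSchraderCMP1973, §2 p. 87 (the involution f ↦ f*)] -/
def osStar (F : 𝓢((Fin n → E), ℂ)) : 𝓢((Fin n → E), ℂ) :=
  starTest (permTest Fin.revPerm F)

/-- `osStar F x = conj (F (x ∘ rev))`. [folklore] -/
@[simp]
theorem osStar_apply (F : 𝓢((Fin n → E), ℂ)) (x : Fin n → E) :
    osStar F x = conj (F fun i => x (Fin.rev i)) := by
  simp [osStar, Function.comp_def]

/-- `f ↦ f*` is an involution (OS 1973 §2). [folklore] -/
@[simp]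
theorem osStar_osStar (F : 𝓢((Fin n → E), ℂ)) : osStar (osStar F) = F := by
  ext x
  simp [Fin.rev_rev]

/-- `f ↦ f*` is additive. [folklore] -/
theorem osStar_add (F G : 𝓢((Fin n → E), ℂ)) : osStar (F + G) = osStar F + osStar G := by
  ext x; simp

/-- `f ↦ f*` is conjugate homogeneous. [folklore] -/
theorem osStar_smul (c : ℂ) (F : 𝓢((Fin n → E), ℂ)) : osStar (c • F) = conj c • osStar F := by
  ext x; simp

/-- `f ↦ f*` commutes with subtraction. [folklore] -/
theorem osStar_sub (F G : 𝓢((Fin n → E), ℂ)) : osStar (F - G) = osStar F - osStar G := by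
  ext x; simp

/-- `0* = 0`. [folklore] -/
@[simp]
theorem osStar_zero : osStar (0 : 𝓢((Fin n → E), ℂ)) = 0 := by
  ext x; simp

/-- `f ↦ f*` commutes with finite sums. [folklore] -/
theorem osStar_sum {ι : Type*} (s : Finset ι) (F : ι → 𝓢((Fin n → E), ℂ)) :
    osStar (∑ i ∈ s, F i) = ∑ i ∈ s, osStar (F i) := by
  ext x; simp

/-- `f ↦ f*` is continuous on `𝓢`. [folklore] -/
theorem continuous_osStar : Continuous (osStar : 𝓢((Fin n → E), ℂ) → 𝓢((Fin n → E), ℂ)) :=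
  starTest.continuous.comp (permTest Fin.revPerm).continuous

/-- `(f₁ ⊗ ⋯ ⊗ fₙ)* = fₙ ⊗ ⋯ ⊗ f₁` for real `fᵢ`. [folklore] -/
theorem IsTensorOf.osStar {F : 𝓢((Fin n → E), ℂ)} {f : Fin n → 𝓢(E, ℝ)}
    (hF : IsTensorOf F fun i => ofRealTest (f i)) :
    IsTensorOf (osStar F) fun i => ofRealTest (f (Fin.rev i)) := by
  intro x
  rw [osStar_apply, hF, map_prod]
  simp only [ofRealTest_apply, Complex.conj_ofReal]
  exact Fintype.prod_equiv Fin.revPerm _ _ fun i => by simp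

/-- `f ↦ f*` commutes with diagonal translations. [folklore] -/
theorem osStar_translateMulti (a : E) (F : 𝓢((Fin n → E), ℂ)) :
    osStar (translateMulti a F) = translateMulti a (osStar F) := by
  ext x; simp

/-- `f ↦ f*` commutes with the diagonal action of linear isometries. [folklore] -/
theorem osStar_linActMulti (L : E ≃ₗᵢ[ℝ] E) (F : 𝓢((Fin n → E), ℂ)) :
    osStar (linActMulti L F) = linActMulti L (osStar F) := by
  ext x; simp

/-- Diagonal translation distributes over `F ⊗ G`. [folklore] -/
theorem translateMulti_appendTensor (a : E) (F : 𝓢((Fin n → E), ℂ)) (G : 𝓢((Fin m → E), ℂ)) :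
    translateMulti a (F.appendTensor G) =
      (translateMulti a F).appendTensor (translateMulti a G) := by
  ext x
  simp only [translateMulti_apply, SchwartzMap.appendTensor_apply]
  rfl

/-- The diagonal action of a linear isometry distributes over `F ⊗ G`. [folklore] -/
theorem linActMulti_appendTensor (L : E ≃ₗᵢ[ℝ] E) (F : 𝓢((Fin n → E), ℂ))
    (G : 𝓢((Fin m → E), ℂ)) :
    linActMulti L (F.appendTensor G) = (linActMulti L F).appendTensor (linActMulti L G) := by
  ext x
  simp only [linActMulti_apply, SchwartzMap.appendTensor_apply]
  rfl

/-- Diagonal translations compose additively. [folklore] -/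
theorem translateMulti_translateMulti (a b : E) (F : 𝓢((Fin n → E), ℂ)) :
    translateMulti a (translateMulti b F) = translateMulti (a + b) F := by
  ext x
  simp only [translateMulti_apply]
  congr 1
  funext i
  abel

/-- Translation by `0` is the identity. [folklore] -/
@[simp]
theorem translateMulti_zero (F : 𝓢((Fin n → E), ℂ)) : translateMulti (0 : E) F = F := by
  ext x; simp

/-- A linear isometry conjugates translation by `a` into translation by `L a`:
`L · (F(· - a)) = (L · F)(· - L a)`. [folklore] -/
theorem linActMulti_translateMulti (L : E ≃ₗᵢ[ℝ] E) (a : E) (F : 𝓢((Fin n → E), ℂ)) :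
    linActMulti L (translateMulti a F) = translateMulti (L a) (linActMulti L F) := by
  ext x
  simp only [linActMulti_apply, translateMulti_apply, map_sub, LinearIsometryEquiv.symm_apply_apply]

/-- Support of a diagonal translate: `supp F(· - a) ⊆ {x | x - a ∈ supp F}`. [folklore] -/
theorem tsupport_translateMulti_subset (a : E) (F : 𝓢((Fin n → E), ℂ)) :
    tsupport (translateMulti a F : (Fin n → E) → ℂ) ⊆
      {x | (fun i => x i - a) ∈ tsupport (F : (Fin n → E) → ℂ)} := by
  have h : (translateMulti a F : (Fin n → E) → ℂ) = (F : (Fin n → E) → ℂ) ∘ fun x i => x i - a :=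
    funext fun x => translateMulti_apply a F x
  rw [h]
  exact tsupport_comp_subset_preimage _ (by fun_prop)

variable {d : ℕ} [NeZero d]

/-- `Θ f* = osAdjoint f` (OS 1973 §2: the combination entering (E2)). [folklore] -/
theorem thetaMulti_osStar (F : 𝓢((Fin n → EuclideanSpace ℝ (Fin d)), ℂ)) :
    thetaMulti d (osStar F) = osAdjoint F := by
  ext x; simp

/-- `(Θ f)* = osAdjoint f`. [folklore] -/
theorem osStar_thetaMulti (F : 𝓢((Fin n → EuclideanSpace ℝ (Fin d)), ℂ)) :
    osStar (thetaMulti d F) = osAdjoint F := by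
  ext x; simp

/-- `osAdjoint (Θ f) = f*`. [folklore] -/
theorem osAdjoint_thetaMulti (F : 𝓢((Fin n → EuclideanSpace ℝ (Fin d)), ℂ)) :
    osAdjoint (thetaMulti d F) = osStar F := by
  ext x; simp [timeReflection_timeReflection]

/-- `Θ` is an involution on `n`-point functions. [folklore] -/
@[simp]
theorem thetaMulti_thetaMulti (F : 𝓢((Fin n → EuclideanSpace ℝ (Fin d)), ℂ)) :
    thetaMulti d (thetaMulti d F) = F := by
  ext x; simp [timeReflection_timeReflection]

/-- The OS adjoint is an involution. [folklore] -/
@[simp]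
theorem osAdjoint_osAdjoint (F : 𝓢((Fin n → EuclideanSpace ℝ (Fin d)), ℂ)) :
    osAdjoint (osAdjoint F) = F := by
  ext x; simp [timeReflection_timeReflection, Fin.rev_rev]

/-- The OS adjoint of `Θ g*`... : `osAdjoint F = (Θ F)*` and `f ↦ f*` commutes with `Θ`. [folklore] -/
theorem osStar_thetaMulti_comm (F : 𝓢((Fin n → EuclideanSpace ℝ (Fin d)), ℂ)) :
    osStar (thetaMulti d F) = thetaMulti d (osStar F) := by
  rw [osStar_thetaMulti, thetaMulti_osStar]

/-- If `X` is supported at negative times then `osAdjoint X` is positive-time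
(OS 1973 §2: `Θ` exchanges `𝒮₊` and `𝒮₋`). [folklore] -/
theorem isPositiveTimeMulti_osAdjoint {X : 𝓢((Fin n → EuclideanSpace ℝ (Fin d)), ℂ)}
    (hX : tsupport (X : (Fin n → EuclideanSpace ℝ (Fin d)) → ℂ) ⊆ {x | ∀ i, x i 0 < 0}) :
    IsPositiveTimeMulti (osAdjoint X) := by
  set φ : (Fin n → EuclideanSpace ℝ (Fin d)) → (Fin n → EuclideanSpace ℝ (Fin d)) :=
    fun x i => timeReflection d (x (Fin.rev i)) with hφ
  have hφc : Continuous φ := by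
    refine continuous_pi fun i => (timeReflection d).continuous.comp (continuous_apply _)
  have h : (osAdjoint X : (Fin n → EuclideanSpace ℝ (Fin d)) → ℂ) =
      (starRingEnd ℂ) ∘ ((X : (Fin n → EuclideanSpace ℝ (Fin d)) → ℂ) ∘ φ) :=
    funext fun x => osAdjoint_apply X x
  intro x hx
  rw [h] at hx
  have hx' : x ∈ tsupport ((X : (Fin n → EuclideanSpace ℝ (Fin d)) → ℂ) ∘ φ) :=
    (tsupport_comp_subset (g := (starRingEnd ℂ)) (map_zero _) _) hx
  have hx'' := tsupport_comp_subset_preimage _ hφc hx'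
  intro j
  have hj := hX hx'' (Fin.rev j)
  simp only [φ, Fin.rev_rev, timeReflection_apply, if_true] at hj
  linarith

end OSStar


/-! ### B. Formal tensor polynomials and the `L²` bound on `𝔖ₙ₊ₘ(F* ⊗ G)` -/

section TPoly

variable {d : ℕ} [NeZero d] {n m : ℕ}

variable (d) in
/-- Formal `ℂ`-combinations of `n`-fold tensor products `f₁ ⊗ ⋯ ⊗ fₙ` of real one-point test
functions (finitely supported coefficients on families `f : Fin n → 𝓢(ℝ^d, ℝ)`): a presentation
of the span of `tensorProducts n` on which the moments of `μ` can be manipulated termwise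
(GJ §6.1, (6.1.15)). [folklore] -/
abbrev TPoly (n : ℕ) : Type := (Fin n → 𝓢(EuclideanSpace ℝ (Fin d), ℝ)) →₀ ℂ

/-- The test function `∑ u(f) · f₁ ⊗ ⋯ ⊗ fₙ ∈ 𝓢((ℝ^d)ⁿ, ℂ)` of a formal combination. [folklore] -/
def polyTensor : TPoly d n →ₗ[ℂ] 𝓢((Fin n → EuclideanSpace ℝ (Fin d)), ℂ) :=
  Finsupp.linearCombination ℂ fun f => SchwartzMap.tensorFin n fun i => ofRealTest (f i)

/-- The random variable `ω ↦ ∑ u(f) ∏ᵢ ω(fᵢ)` of a formal combination. [folklore] -/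
def polyFn : TPoly d n →ₗ[ℂ] (FieldConfig (EuclideanSpace ℝ (Fin d)) → ℂ) :=
  Finsupp.linearCombination ℂ monomialFn

omit [NeZero d] in
/-- `polyTensor u = ∑_{f ∈ supp u} u f • (f₁ ⊗ ⋯ ⊗ fₙ)`. [folklore] -/
theorem polyTensor_apply (u : TPoly d n) :
    polyTensor u = ∑ f ∈ u.support, u f • SchwartzMap.tensorFin n fun i => ofRealTest (f i) := by
  rw [polyTensor, Finsupp.linearCombination_apply, Finsupp.sum]

omit [NeZero d] in
/-- `polyFn u ω = ∑_{f ∈ supp u} u f · ∏ᵢ ω(fᵢ)`. [folklore] -/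
theorem polyFn_apply (u : TPoly d n) (ω : FieldConfig (EuclideanSpace ℝ (Fin d))) :
    polyFn u ω = ∑ f ∈ u.support, u f * monomialFn f ω := by
  have h := Finsupp.apply_linearCombination ℂ (LinearMap.proj ω :
    (FieldConfig (EuclideanSpace ℝ (Fin d)) → ℂ) →ₗ[ℂ] ℂ) (monomialFn (d := d) (n := n)) u
  simp only [LinearMap.coe_proj, Function.eval] at h
  rw [polyFn, h, Finsupp.linearCombination_apply, Finsupp.sum]
  rfl

omit [NeZero d] in
/-- `polyFn u` is continuous on configurations. [folklore] -/
theorem continuous_polyFn (u : TPoly d n) : Continuous (polyFn u) := by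
  have : polyFn u = fun ω => ∑ f ∈ u.support, u f * monomialFn f ω := funext (polyFn_apply u)
  rw [this]
  exact continuous_finsetSum _ fun f _ => continuous_const.mul (continuous_monomial _)

omit [NeZero d] in
/-- `polyFn u ∈ L²(dμ)` under `HasAllMoments`. [folklore] -/
theorem HasAllMoments.memLp_two_polyFn {μ : Measure (FieldConfig (EuclideanSpace ℝ (Fin d)))}
    [IsFiniteMeasure μ] (hμ : HasAllMoments μ) (u : TPoly d n) : MemLp (polyFn u) 2 μ := by
  have : polyFn u = fun ω => ∑ f ∈ u.support, u f * monomialFn f ω := funext (polyFn_apply u)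
  rw [this]
  exact memLp_finsetSum _ fun f _ => (hμ.memLp_two_monomialFn _).const_mul _

omit [NeZero d] in
/-- Tensor products of real test functions are exactly the `tensorFin` of real families. [folklore] -/
theorem tensorProducts_eq_range :
    tensorProducts (E := EuclideanSpace ℝ (Fin d)) n =
      Set.range fun f : Fin n → 𝓢(EuclideanSpace ℝ (Fin d), ℝ) =>
        SchwartzMap.tensorFin n fun i => ofRealTest (f i) := by
  ext F
  constructor
  · rintro ⟨f, hF⟩
    exact ⟨f, (isTensorOf_tensorFin _).unique hF⟩
  · rintro ⟨f, rfl⟩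
    exact ⟨f, isTensorOf_tensorFin _⟩

omit [NeZero d] in
/-- The span of the tensor products is the range of `polyTensor`. [folklore] -/
theorem range_polyTensor :
    LinearMap.range (polyTensor (d := d) (n := n)) =
      Submodule.span ℂ (tensorProducts (E := EuclideanSpace ℝ (Fin d)) n) := by
  rw [polyTensor, Finsupp.range_linearCombination, tensorProducts_eq_range]

omit [NeZero d] in
/-- Membership in the span of tensor products, as a presentation by a formal combination. [folklore] -/
theorem mem_span_tensorProducts_iff {F : 𝓢((Fin n → EuclideanSpace ℝ (Fin d)), ℂ)} :
    F ∈ Submodule.span ℂ (tensorProducts (E := EuclideanSpace ℝ (Fin d)) n) ↔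
      ∃ u : TPoly d n, polyTensor u = F := by
  rw [← range_polyTensor, LinearMap.mem_range]

/-- Sesquilinear expansion of `T((∑ᵢ aᵢFᵢ)* ⊗ ∑ⱼ bⱼGⱼ)` for a linear functional `T`. [folklore] -/
theorem apply_osStar_appendTensor_sum_smul {E : Type*} [NormedAddCommGroup E] [NormedSpace ℝ E]
    (T : 𝓢((Fin (n + m) → E), ℂ) →L[ℂ] ℂ) {ι κ : Type*} (s : Finset ι) (t : Finset κ)
    (a : ι → ℂ) (b : κ → ℂ) (F : ι → 𝓢((Fin n → E), ℂ)) (G : κ → 𝓢((Fin m → E), ℂ)) :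
    T ((osStar (∑ i ∈ s, a i • F i)).appendTensor (∑ j ∈ t, b j • G j)) =
      ∑ i ∈ s, ∑ j ∈ t, conj (a i) * b j * T ((osStar (F i)).appendTensor (G j)) := by
  rw [osStar_sum, SchwartzMap.appendTensor_sum_left, map_sum]
  refine Finset.sum_congr rfl fun i _ => ?_
  rw [SchwartzMap.appendTensor_sum_right, map_sum]
  refine Finset.sum_congr rfl fun j _ => ?_
  rw [osStar_smul, SchwartzMap.appendTensor_smul_left, SchwartzMap.appendTensor_smul_right,
    map_smul, map_smul, smul_eq_mul, smul_eq_mul]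
  ring

variable {μ : Measure (FieldConfig (EuclideanSpace ℝ (Fin d)))}
  {S : SchwingerFamily (EuclideanSpace ℝ (Fin d))}

omit [NeZero d] in
/-- `𝔖ₙ(f₁ ⊗ ⋯ ⊗ fₙ) = ∫ ∏ᵢ ω(fᵢ) dμ` as a complex integral. [folklore] -/
theorem IsSchwingerFamilyOf.apply_tensorFin (hS : IsSchwingerFamilyOf μ S)
    (f : Fin n → 𝓢(EuclideanSpace ℝ (Fin d), ℝ)) :
    S n (SchwartzMap.tensorFin n fun i => ofRealTest (f i)) = ∫ ω, monomialFn f ω ∂μ := by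
  rw [hS n f _ (isTensorOf_tensorFin _), moment, ← integral_complex_ofReal]
  simp only [monomialFn, Complex.ofReal_prod]

omit [NeZero d] in
/-- **`𝔖ₙ` on the span of tensor products is the expectation of the field polynomial**:
`𝔖ₙ(∑ u(f) f₁ ⊗ ⋯ ⊗ fₙ) = ∫ ∑ u(f) ∏ᵢ ω(fᵢ) dμ` (GJ §6.1 (6.1.15)). [cite: GlimmJaffeQP1987, §6.1 (6.1.15)] -/
theorem IsSchwingerFamilyOf.apply_polyTensor [IsFiniteMeasure μ] (hS : IsSchwingerFamilyOf μ S)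
    (hμ : HasAllMoments μ) (u : TPoly d n) :
    S n (polyTensor u) = ∫ ω, polyFn u ω ∂μ := by
  rw [polyTensor_apply, map_sum]
  simp only [(S n).map_smul, smul_eq_mul, hS.apply_tensorFin]
  have : (fun ω => polyFn u ω) = fun ω => ∑ f ∈ u.support, u f * monomialFn f ω :=
    funext (polyFn_apply u)
  have hint : ∀ f : Fin n → 𝓢(EuclideanSpace ℝ (Fin d), ℝ),
      Integrable (fun ω => u f * monomialFn f ω) μ :=
    fun f => (show Integrable (monomialFn f) μ from hμ.integrable_monomial f).const_mul (u f)
  rw [this, integral_finsetSum _ fun f _ => hint f]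
  simp only [integral_const_mul]

omit [NeZero d] in
/-- `𝔖ₙ₊ₘ((f₁ ⊗ ⋯ ⊗ fₙ)* ⊗ (g₁ ⊗ ⋯ ⊗ gₘ)) = ∫ conj (∏ᵢ ω(fᵢ)) ∏ⱼ ω(gⱼ) dμ` for real `fᵢ, gⱼ`
(GJ §6.1 (6.1.15)). [folklore] -/
theorem IsSchwingerFamilyOf.apply_osStar_appendTensor_tensorFin (hS : IsSchwingerFamilyOf μ S)
    (f : Fin n → 𝓢(EuclideanSpace ℝ (Fin d), ℝ)) (g : Fin m → 𝓢(EuclideanSpace ℝ (Fin d), ℝ)) :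
    S (n + m) ((osStar (SchwartzMap.tensorFin n fun i => ofRealTest (f i))).appendTensor
      (SchwartzMap.tensorFin m fun j => ofRealTest (g j))) =
      ∫ ω, conj (monomialFn f ω) * monomialFn g ω ∂μ := by
  have hT : IsTensorOf ((osStar (SchwartzMap.tensorFin n fun i => ofRealTest (f i))).appendTensor
      (SchwartzMap.tensorFin m fun j => ofRealTest (g j)))
      fun k => ofRealTest (Fin.append (fun i => f (Fin.rev i)) g k) := by
    rw [← append_ofRealTest]
    exact (isTensorOf_tensorFin _).osStar.appendTensor (isTensorOf_tensorFin _)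
  rw [hS (n + m) _ _ hT, moment, ← integral_complex_ofReal]
  refine integral_congr_ae (ae_of_all _ fun ω => ?_)
  simp only [monomialFn, map_prod, Complex.conj_ofReal, Fin.prod_univ_add, Fin.append_left,
    Fin.append_right, Complex.ofReal_mul, Complex.ofReal_prod]
  congr 1
  exact Fintype.prod_equiv Fin.revPerm _ _ fun i => by simp

omit [NeZero d] in
/-- Integrability of `conj (∏ᵢ ω(fᵢ)) ∏ⱼ ω(gⱼ)` (a monomial of degree `n + m`). [folklore] -/
theorem HasAllMoments.integrable_conj_monomialFn_mul [IsFiniteMeasure μ] (hμ : HasAllMoments μ)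
    (f : Fin n → 𝓢(EuclideanSpace ℝ (Fin d), ℝ)) (g : Fin m → 𝓢(EuclideanSpace ℝ (Fin d), ℝ)) :
    Integrable (fun ω => conj (monomialFn f ω) * monomialFn g ω) μ := by
  refine (hμ.integrable_monomial (Fin.append f g)).congr (ae_of_all _ fun ω => ?_)
  simp only [monomialFn, map_prod, Complex.conj_ofReal, Fin.prod_univ_add, Fin.append_left,
    Fin.append_right]

omit [NeZero d] in
/-- **`𝔖ₙ₊ₘ(F* ⊗ G)` on spans of tensor products is an `L²(dμ)` inner product**:
`𝔖ₙ₊ₘ((∑ u(f) ⊗f)* ⊗ ∑ u'(g) ⊗g) = ∫ conj (P_u(ω)) P_{u'}(ω) dμ` (GJ §6.1 (6.1.15)). [cite: GlimmJaffeQP1987, §6.1 (6.1.15)] -/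
theorem IsSchwingerFamilyOf.apply_osStar_appendTensor_polyTensor [IsFiniteMeasure μ]
    (hS : IsSchwingerFamilyOf μ S) (hμ : HasAllMoments μ) (u : TPoly d n) (u' : TPoly d m) :
    S (n + m) ((osStar (polyTensor u)).appendTensor (polyTensor u')) =
      ∫ ω, conj (polyFn u ω) * polyFn u' ω ∂μ := by
  rw [polyTensor_apply, polyTensor_apply, apply_osStar_appendTensor_sum_smul]
  simp only [hS.apply_osStar_appendTensor_tensorFin]
  have hrhs : (fun ω => conj (polyFn u ω) * polyFn u' ω) = fun ω =>
      ∑ f ∈ u.support, ∑ g ∈ u'.support,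
        conj (u f) * u' g * (conj (monomialFn f ω) * monomialFn g ω) := by
    funext ω
    rw [polyFn_apply, polyFn_apply, map_sum, Finset.sum_mul]
    refine Finset.sum_congr rfl fun f _ => ?_
    rw [Finset.mul_sum]
    refine Finset.sum_congr rfl fun g _ => ?_
    rw [map_mul]
    ring
  rw [hrhs, integral_finsetSum _ fun f _ => integrable_finsetSum _ fun g _ =>
    (hμ.integrable_conj_monomialFn_mul f g).const_mul _]
  refine Finset.sum_congr rfl fun f _ => ?_
  rw [integral_finsetSum _ fun g _ => (hμ.integrable_conj_monomialFn_mul f g).const_mul _]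
  refine Finset.sum_congr rfl fun g _ => ?_
  rw [integral_const_mul]

/-- The quadratic form `N(F) = Re 𝔖ₙ₊ₙ(F* ⊗ F)` of a Schwinger family (for the Schwinger family of a
measure and `F` in the span of tensor products this is `∫ |P_F|² dμ`). [folklore] -/
def SchwingerFamily.sqNorm {E : Type*} [NormedAddCommGroup E] [NormedSpace ℝ E]
    (S : SchwingerFamily E) (n : ℕ) (F : 𝓢((Fin n → E), ℂ)) : ℝ :=
  (S (n + n) ((osStar F).appendTensor F)).re

omit [NeZero d] in
/-- On the span, `N(∑ u(f) ⊗f) = ∫ |P_u|² dμ`. [folklore] -/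
theorem IsSchwingerFamilyOf.sqNorm_polyTensor [IsFiniteMeasure μ] (hS : IsSchwingerFamilyOf μ S)
    (hμ : HasAllMoments μ) (u : TPoly d n) :
    S.sqNorm n (polyTensor u) = ∫ ω, ‖polyFn u ω‖ ^ 2 ∂μ := by
  rw [SchwingerFamily.sqNorm, hS.apply_osStar_appendTensor_polyTensor hμ]
  have : (fun ω => conj (polyFn u ω) * polyFn u ω) = fun ω => ((‖polyFn u ω‖ ^ 2 : ℝ) : ℂ) := by
    funext ω
    rw [Complex.conj_mul', Complex.ofReal_pow]
  rw [this, integral_complex_ofReal, Complex.ofReal_re]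

omit [NeZero d] in
/-- **Cauchy–Schwarz on the span**: `|𝔖ₙ₊ₘ(F* ⊗ G)| ≤ N(F)^{1/2} N(G)^{1/2}` for `F, G` finite
combinations of tensor products (it is `|∫ conj P_F · P_G| ≤ ‖P_F‖₂ ‖P_G‖₂`). [folklore] -/
theorem IsSchwingerFamilyOf.norm_apply_osStar_appendTensor_polyTensor_le [IsFiniteMeasure μ]
    (hS : IsSchwingerFamilyOf μ S) (hμ : HasAllMoments μ) (u : TPoly d n) (u' : TPoly d m) :
    ‖S (n + m) ((osStar (polyTensor u)).appendTensor (polyTensor u'))‖ ≤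
      √(S.sqNorm n (polyTensor u)) * √(S.sqNorm m (polyTensor u')) := by
  rw [hS.apply_osStar_appendTensor_polyTensor hμ, hS.sqNorm_polyTensor hμ, hS.sqNorm_polyTensor hμ]
  have hA : MemLp (fun ω => conj (polyFn u ω)) 2 μ := by
    have h := hμ.memLp_two_polyFn u
    exact ⟨continuous_conj.comp_aestronglyMeasurable h.1,
      by rw [eLpNorm_congr_norm_ae (ae_of_all _ fun ω => RCLike.norm_conj _)]; exact h.2⟩
  have h := norm_integral_mul_le_sqrt hA (hμ.memLp_two_polyFn u')
  simpa only [RCLike.norm_conj] using h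

end TPoly

/-! ### C. Continuity of tensor operations; the `L²` bound for all test functions -/

section SqNorm

variable {E : Type*} [NormedAddCommGroup E] [NormedSpace ℝ E] {n m : ℕ}

/-- Joint continuity of `(F, G) ↦ F ⊗ G` on `𝓢 × 𝓢`. [folklore] -/
theorem continuous_appendTensor :
    Continuous fun p : 𝓢((Fin n → E), ℂ) × 𝓢((Fin m → E), ℂ) => p.1.appendTensor p.2 :=
  continuous_iff_continuousAt.2 fun p =>
    SchwartzMap.tendsto_appendTensor (continuous_fst.tendsto p) (continuous_snd.tendsto p)

/-- Continuity of `F ↦ F* ⊗ G`. [folklore] -/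
theorem continuous_osStar_appendTensor_left (G : 𝓢((Fin m → E), ℂ)) :
    Continuous fun F : 𝓢((Fin n → E), ℂ) => (osStar F).appendTensor G :=
  continuous_appendTensor.comp (continuous_osStar.prodMk continuous_const)

/-- Continuity of `G ↦ F* ⊗ G`. [folklore] -/
theorem continuous_osStar_appendTensor_right (F : 𝓢((Fin n → E), ℂ)) :
    Continuous fun G : 𝓢((Fin m → E), ℂ) => (osStar F).appendTensor G :=
  continuous_appendTensor.comp (continuous_const.prodMk continuous_id)

/-- Continuity of the quadratic form `N`. [folklore] -/
theorem SchwingerFamily.continuous_sqNorm (S : SchwingerFamily E) (n : ℕ) :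
    Continuous (S.sqNorm n) :=
  Complex.continuous_re.comp ((S (n + n)).continuous.comp
    (continuous_appendTensor.comp (continuous_osStar.prodMk continuous_id)))

/-- `N(0) = 0`. [folklore] -/
@[simp]
theorem SchwingerFamily.sqNorm_zero (S : SchwingerFamily E) (n : ℕ) : S.sqNorm n 0 = 0 := by
  have h : (0 : 𝓢((Fin n → E), ℂ)).appendTensor (0 : 𝓢((Fin n → E), ℂ)) = 0 := by
    ext x; simp
  rw [SchwingerFamily.sqNorm, osStar_zero, h, map_zero, Complex.zero_re]

/-- `N` is invariant under diagonal translations when `𝔖` is (E1). [folklore] -/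
theorem SchwingerFamily.IsEuclideanCovariant.sqNorm_translateMulti {S : SchwingerFamily E}
    (hE1 : S.IsEuclideanCovariant) (n : ℕ) (a : E) (F : 𝓢((Fin n → E), ℂ)) :
    S.sqNorm n (Literature.MathematicalPhysics.QuantumLattice.translateMulti a F) = S.sqNorm n F := by
  rw [SchwingerFamily.sqNorm, SchwingerFamily.sqNorm, osStar_translateMulti,
    ← translateMulti_appendTensor, hE1.translateMulti]

/-- `N` is invariant under the diagonal action of linear isometries when `𝔖` is (E1). [folklore] -/
theorem SchwingerFamily.IsEuclideanCovariant.sqNorm_linActMulti {S : SchwingerFamily E}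
    (hE1 : S.IsEuclideanCovariant) (n : ℕ) (L : E ≃ₗᵢ[ℝ] E) (F : 𝓢((Fin n → E), ℂ)) :
    S.sqNorm n (Literature.MathematicalPhysics.QuantumLattice.linActMulti L F) = S.sqNorm n F := by
  rw [SchwingerFamily.sqNorm, SchwingerFamily.sqNorm, osStar_linActMulti,
    ← linActMulti_appendTensor, hE1.linActMulti]

variable {d : ℕ} [NeZero d]
variable {μ : Measure (FieldConfig (EuclideanSpace ℝ (Fin d)))}
  {S : SchwingerFamily (EuclideanSpace ℝ (Fin d))}

omit [NeZero d] in
/-- **Positivity of `N` on all of `𝓢`** (density of tensor products, `denseSpan_tensorProducts_holds`,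
and continuity). [folklore] -/
theorem IsSchwingerFamilyOf.sqNorm_nonneg [IsFiniteMeasure μ] (hS : IsSchwingerFamilyOf μ S)
    (hμ : HasAllMoments μ) (n : ℕ) (F : 𝓢((Fin n → EuclideanSpace ℝ (Fin d)), ℂ)) :
    0 ≤ S.sqNorm n F := by
  have hcl : IsClosed {F : 𝓢((Fin n → EuclideanSpace ℝ (Fin d)), ℂ) | 0 ≤ S.sqNorm n F} :=
    isClosed_le continuous_const (S.continuous_sqNorm n)
  have hsub : (Submodule.span ℂ (tensorProducts (E := EuclideanSpace ℝ (Fin d)) n) :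
      Set 𝓢((Fin n → EuclideanSpace ℝ (Fin d)), ℂ)) ⊆ {F | 0 ≤ S.sqNorm n F} := by
    intro F hF
    obtain ⟨u, rfl⟩ := mem_span_tensorProducts_iff.1 hF
    show 0 ≤ S.sqNorm n (polyTensor u)
    rw [hS.sqNorm_polyTensor hμ]
    exact integral_nonneg fun ω => by positivity
  have h := (denseSpan_tensorProducts_holds (E := EuclideanSpace ℝ (Fin d)) n).closure_eq
  have hmem : F ∈ closure (Submodule.span ℂ (tensorProducts (E := EuclideanSpace ℝ (Fin d)) n) :
      Set 𝓢((Fin n → EuclideanSpace ℝ (Fin d)), ℂ)) := by rw [h]; exact Set.mem_univ _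
  exact hcl.closure_subset_iff.2 hsub hmem

omit [NeZero d] in
/-- **The `L²` bound** `|𝔖ₙ₊ₘ(F* ⊗ G)| ≤ N(F)^{1/2} N(G)^{1/2}` **for all** `F, G ∈ 𝓢`: Cauchy–Schwarz
on the span of tensor products (`norm_apply_osStar_appendTensor_polyTensor_le`), extended by
density (`denseSpan_tensorProducts_holds`) and continuity, first in `F`, then in `G`
(GJ §6.1: `𝔖ₙ₊ₘ(ΘF̄ ⊗ G) = ⟨F^, G^⟩_𝓗`). [cite: GlimmJaffeQP1987, §6.1 (6.1.15) and Prop. 6.1.4] -/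
theorem IsSchwingerFamilyOf.norm_apply_osStar_appendTensor_le [IsFiniteMeasure μ]
    (hS : IsSchwingerFamilyOf μ S) (hμ : HasAllMoments μ)
    (F : 𝓢((Fin n → EuclideanSpace ℝ (Fin d)), ℂ)) (G : 𝓢((Fin m → EuclideanSpace ℝ (Fin d)), ℂ)) :
    ‖S (n + m) ((osStar F).appendTensor G)‖ ≤ √(S.sqNorm n F) * √(S.sqNorm m G) := by
  have hDn := (denseSpan_tensorProducts_holds (E := EuclideanSpace ℝ (Fin d)) n).closure_eq
  have hDm := (denseSpan_tensorProducts_holds (E := EuclideanSpace ℝ (Fin d)) m).closure_eq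
  -- Step 1: `G` in the span, all `F`.
  have step1 : ∀ G ∈ Submodule.span ℂ (tensorProducts (E := EuclideanSpace ℝ (Fin d)) m),
      ∀ F : 𝓢((Fin n → EuclideanSpace ℝ (Fin d)), ℂ),
        ‖S (n + m) ((osStar F).appendTensor G)‖ ≤ √(S.sqNorm n F) * √(S.sqNorm m G) := by
    intro G hG F
    obtain ⟨u', rfl⟩ := mem_span_tensorProducts_iff.1 hG
    have hcl : IsClosed {F : 𝓢((Fin n → EuclideanSpace ℝ (Fin d)), ℂ) |
        ‖S (n + m) ((osStar F).appendTensor (polyTensor u'))‖ ≤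
          √(S.sqNorm n F) * √(S.sqNorm m (polyTensor u'))} :=
      isClosed_le ((S (n + m)).continuous.comp (continuous_osStar_appendTensor_left _)).norm
        ((Real.continuous_sqrt.comp (S.continuous_sqNorm n)).mul continuous_const)
    have hsub : (Submodule.span ℂ (tensorProducts (E := EuclideanSpace ℝ (Fin d)) n) :
        Set 𝓢((Fin n → EuclideanSpace ℝ (Fin d)), ℂ)) ⊆ {F |
        ‖S (n + m) ((osStar F).appendTensor (polyTensor u'))‖ ≤
          √(S.sqNorm n F) * √(S.sqNorm m (polyTensor u'))} := by
      intro F hF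
      obtain ⟨u, rfl⟩ := mem_span_tensorProducts_iff.1 hF
      exact hS.norm_apply_osStar_appendTensor_polyTensor_le hμ u u'
    have hmem : F ∈ closure (Submodule.span ℂ (tensorProducts (E := EuclideanSpace ℝ (Fin d)) n) :
        Set 𝓢((Fin n → EuclideanSpace ℝ (Fin d)), ℂ)) := by rw [hDn]; exact Set.mem_univ _
    exact hcl.closure_subset_iff.2 hsub hmem
  -- Step 2: all `G`.
  have hcl : IsClosed {G : 𝓢((Fin m → EuclideanSpace ℝ (Fin d)), ℂ) |
      ‖S (n + m) ((osStar F).appendTensor G)‖ ≤ √(S.sqNorm n F) * √(S.sqNorm m G)} :=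
    isClosed_le ((S (n + m)).continuous.comp (continuous_osStar_appendTensor_right _)).norm
      (continuous_const.mul (Real.continuous_sqrt.comp (S.continuous_sqNorm m)))
  have hmem : G ∈ closure (Submodule.span ℂ (tensorProducts (E := EuclideanSpace ℝ (Fin d)) m) :
      Set 𝓢((Fin m → EuclideanSpace ℝ (Fin d)), ℂ)) := by rw [hDm]; exact Set.mem_univ _
  exact hcl.closure_subset_iff.2 (fun G hG => step1 G hG F) hmem

omit [NeZero d] in
/-- The `L²` bound in the form `|𝔖ₙ₊ₘ(F ⊗ G)| ≤ N(F*)^{1/2} N(G)^{1/2}`. [folklore] -/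
theorem IsSchwingerFamilyOf.norm_apply_appendTensor_le [IsFiniteMeasure μ]
    (hS : IsSchwingerFamilyOf μ S) (hμ : HasAllMoments μ)
    (F : 𝓢((Fin n → EuclideanSpace ℝ (Fin d)), ℂ)) (G : 𝓢((Fin m → EuclideanSpace ℝ (Fin d)), ℂ)) :
    ‖S (n + m) (F.appendTensor G)‖ ≤ √(S.sqNorm n (osStar F)) * √(S.sqNorm m G) := by
  simpa only [osStar_osStar] using hS.norm_apply_osStar_appendTensor_le hμ (osStar F) G

end SqNorm


/-! ### D. Time clustering of the Schwinger functions of an OS measure -/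

section TimeCluster

variable {d : ℕ} [NeZero d] {n m : ℕ}

/-- A uniform-approximation limit lemma (Moore–Osgood): if `c_k → ℓ_k` as `s → ∞` for each `k`,
`sup_s |c_k(s) - c(s)| ≤ ε_k → 0` and `ℓ_k → ℓ`, then `c → ℓ`. [folklore] -/
theorem tendsto_of_uniform_approx {c : ℝ → ℂ} {ck : ℕ → ℝ → ℂ} {ℓk : ℕ → ℂ} {ℓ : ℂ} {ε : ℕ → ℝ}
    (hck : ∀ k, Tendsto (ck k) atTop (𝓝 (ℓk k))) (hbound : ∀ k s, ‖ck k s - c s‖ ≤ ε k)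
    (hε : Tendsto ε atTop (𝓝 0)) (hℓ : Tendsto ℓk atTop (𝓝 ℓ)) : Tendsto c atTop (𝓝 ℓ) := by
  refine Metric.tendsto_atTop.2 fun δ hδ => ?_
  have h1 : ∀ᶠ k in atTop, ε k < δ / 3 := hε (Iio_mem_nhds (by positivity))
  have h2 : ∀ᶠ k in atTop, dist (ℓk k) ℓ < δ / 3 := Metric.tendsto_nhds.1 hℓ _ (by positivity)
  obtain ⟨k, hk1, hk2⟩ := (h1.and h2).exists
  obtain ⟨S₀, hS₀⟩ := Metric.tendsto_atTop.1 (hck k) (δ / 3) (by positivity)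
  refine ⟨S₀, fun s hs => ?_⟩
  have d1 : dist (c s) (ck k s) < δ / 3 := by
    rw [dist_comm, dist_eq_norm]; exact (hbound k s).trans_lt hk1
  have d2 : dist (ck k s) (ℓk k) < δ / 3 := hS₀ s hs
  have h4 := dist_triangle4 (c s) (ck k s) (ℓk k) ℓ
  linarith

namespace SchwingerFamily

variable (S : SchwingerFamily (EuclideanSpace ℝ (Fin d)))

/-- The time-translated correlation `s ↦ 𝔖ₙ₊ₘ(A ⊗ B(· - s e₀))` of two multi-point test functions
(the quantity whose `s → ∞` limit is the cluster property, OS 1973 §3 (E4) with `a = e₀` after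
a rotation; GJ (19.7.2)). [cite: OsterwalderSchraderCMP1973, §3 (E4)] -/
def timeCluster (A : 𝓢((Fin n → EuclideanSpace ℝ (Fin d)), ℂ))
    (B : 𝓢((Fin m → EuclideanSpace ℝ (Fin d)), ℂ)) (s : ℝ) : ℂ :=
  S (n + m) (A.appendTensor (translateMulti (EuclideanSpace.single 0 s) B))

/-- Time clustering of the pair `(A, B)`: `𝔖ₙ₊ₘ(A ⊗ B(· - s e₀)) → 𝔖ₙ(A) 𝔖ₘ(B)` as `s → +∞`. [cite: OsterwalderSchraderCMP1973, §3 (E4)] -/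
def TimeClusters (A : 𝓢((Fin n → EuclideanSpace ℝ (Fin d)), ℂ))
    (B : 𝓢((Fin m → EuclideanSpace ℝ (Fin d)), ℂ)) : Prop :=
  Tendsto (S.timeCluster A B) atTop (𝓝 (S n A * S m B))

variable {S}

/-- Additivity of `timeCluster` in `A`. [folklore] -/
theorem timeCluster_add_left (A A' : 𝓢((Fin n → EuclideanSpace ℝ (Fin d)), ℂ))
    (B : 𝓢((Fin m → EuclideanSpace ℝ (Fin d)), ℂ)) (s : ℝ) :
    S.timeCluster (A + A') B s = S.timeCluster A B s + S.timeCluster A' B s := by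
  simp only [timeCluster, SchwartzMap.appendTensor_add_left, map_add]

/-- Additivity of `timeCluster` in `B`. [folklore] -/
theorem timeCluster_add_right (A : 𝓢((Fin n → EuclideanSpace ℝ (Fin d)), ℂ))
    (B B' : 𝓢((Fin m → EuclideanSpace ℝ (Fin d)), ℂ)) (s : ℝ) :
    S.timeCluster A (B + B') s = S.timeCluster A B s + S.timeCluster A B' s := by
  simp only [timeCluster, map_add, SchwartzMap.appendTensor_add_right]

/-- Homogeneity of `timeCluster` in `A`. [folklore] -/
theorem timeCluster_smul_left (c : ℂ) (A : 𝓢((Fin n → EuclideanSpace ℝ (Fin d)), ℂ))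
    (B : 𝓢((Fin m → EuclideanSpace ℝ (Fin d)), ℂ)) (s : ℝ) :
    S.timeCluster (c • A) B s = c * S.timeCluster A B s := by
  simp only [timeCluster, SchwartzMap.appendTensor_smul_left, map_smul, smul_eq_mul]

/-- Homogeneity of `timeCluster` in `B`. [folklore] -/
theorem timeCluster_smul_right (c : ℂ) (A : 𝓢((Fin n → EuclideanSpace ℝ (Fin d)), ℂ))
    (B : 𝓢((Fin m → EuclideanSpace ℝ (Fin d)), ℂ)) (s : ℝ) :
    S.timeCluster A (c • B) s = c * S.timeCluster A B s := by
  simp only [timeCluster, map_smul, SchwartzMap.appendTensor_smul_right, smul_eq_mul]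

/-- Subtractivity of `timeCluster` in `A`. [folklore] -/
theorem timeCluster_sub_left (A A' : 𝓢((Fin n → EuclideanSpace ℝ (Fin d)), ℂ))
    (B : 𝓢((Fin m → EuclideanSpace ℝ (Fin d)), ℂ)) (s : ℝ) :
    S.timeCluster (A - A') B s = S.timeCluster A B s - S.timeCluster A' B s := by
  simp only [timeCluster, SchwartzMap.appendTensor_sub_left, map_sub]

/-- Subtractivity of `timeCluster` in `B`. [folklore] -/
theorem timeCluster_sub_right (A : 𝓢((Fin n → EuclideanSpace ℝ (Fin d)), ℂ))
    (B B' : 𝓢((Fin m → EuclideanSpace ℝ (Fin d)), ℂ)) (s : ℝ) :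
    S.timeCluster A (B - B') s = S.timeCluster A B s - S.timeCluster A B' s := by
  simp only [timeCluster, map_sub, SchwartzMap.appendTensor_sub_right]

/-- `timeCluster 0 B = 0`. [folklore] -/
@[simp]
theorem timeCluster_zero_left (B : 𝓢((Fin m → EuclideanSpace ℝ (Fin d)), ℂ)) (s : ℝ) :
    S.timeCluster (0 : 𝓢((Fin n → EuclideanSpace ℝ (Fin d)), ℂ)) B s = 0 := by
  have h := timeCluster_smul_left (S := S) 0 (0 : 𝓢((Fin n → EuclideanSpace ℝ (Fin d)), ℂ)) B s
  rwa [zero_smul, zero_mul] at h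

/-- `timeCluster A 0 = 0`. [folklore] -/
@[simp]
theorem timeCluster_zero_right (A : 𝓢((Fin n → EuclideanSpace ℝ (Fin d)), ℂ)) (s : ℝ) :
    S.timeCluster A (0 : 𝓢((Fin m → EuclideanSpace ℝ (Fin d)), ℂ)) s = 0 := by
  have h := timeCluster_smul_right (S := S) 0 A (0 : 𝓢((Fin m → EuclideanSpace ℝ (Fin d)), ℂ)) s
  rwa [zero_smul, zero_mul] at h

/-- Time clustering is additive in `A`. [folklore] -/
theorem TimeClusters.add_left {A A' : 𝓢((Fin n → EuclideanSpace ℝ (Fin d)), ℂ)}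
    {B : 𝓢((Fin m → EuclideanSpace ℝ (Fin d)), ℂ)} (h : S.TimeClusters A B)
    (h' : S.TimeClusters A' B) : S.TimeClusters (A + A') B := by
  unfold TimeClusters at *
  have := h.add h'
  simp only [← timeCluster_add_left] at this
  rwa [map_add, add_mul]

/-- Time clustering is additive in `B`. [folklore] -/
theorem TimeClusters.add_right {A : 𝓢((Fin n → EuclideanSpace ℝ (Fin d)), ℂ)}
    {B B' : 𝓢((Fin m → EuclideanSpace ℝ (Fin d)), ℂ)} (h : S.TimeClusters A B)
    (h' : S.TimeClusters A B') : S.TimeClusters A (B + B') := by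
  unfold TimeClusters at *
  have := h.add h'
  simp only [← timeCluster_add_right] at this
  rwa [map_add, mul_add]

/-- Time clustering is homogeneous in `A`. [folklore] -/
theorem TimeClusters.smul_left (c : ℂ) {A : 𝓢((Fin n → EuclideanSpace ℝ (Fin d)), ℂ)}
    {B : 𝓢((Fin m → EuclideanSpace ℝ (Fin d)), ℂ)} (h : S.TimeClusters A B) :
    S.TimeClusters (c • A) B := by
  unfold TimeClusters at *
  have := h.const_mul c
  simp only [← timeCluster_smul_left] at this
  rwa [map_smul, smul_eq_mul, mul_assoc]

/-- Time clustering is homogeneous in `B`. [folklore] -/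
theorem TimeClusters.smul_right (c : ℂ) {A : 𝓢((Fin n → EuclideanSpace ℝ (Fin d)), ℂ)}
    {B : 𝓢((Fin m → EuclideanSpace ℝ (Fin d)), ℂ)} (h : S.TimeClusters A B) :
    S.TimeClusters A (c • B) := by
  unfold TimeClusters at *
  have := h.const_mul c
  simp only [← timeCluster_smul_right] at this
  rwa [map_smul, smul_eq_mul, mul_left_comm]

/-- `(0, B)` clusters trivially. [folklore] -/
theorem timeClusters_zero_left (B : 𝓢((Fin m → EuclideanSpace ℝ (Fin d)), ℂ)) :
    S.TimeClusters (0 : 𝓢((Fin n → EuclideanSpace ℝ (Fin d)), ℂ)) B := by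
  have h : S.timeCluster (0 : 𝓢((Fin n → EuclideanSpace ℝ (Fin d)), ℂ)) B = fun _ => 0 :=
    funext fun s => timeCluster_zero_left B s
  unfold TimeClusters
  rw [h, map_zero, zero_mul]
  exact tendsto_const_nhds

/-- `(A, 0)` clusters trivially. [folklore] -/
theorem timeClusters_zero_right (A : 𝓢((Fin n → EuclideanSpace ℝ (Fin d)), ℂ)) :
    S.TimeClusters A (0 : 𝓢((Fin m → EuclideanSpace ℝ (Fin d)), ℂ)) := by
  have h : S.timeCluster A (0 : 𝓢((Fin m → EuclideanSpace ℝ (Fin d)), ℂ)) = fun _ => 0 :=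
    funext fun s => timeCluster_zero_right A s
  unfold TimeClusters
  rw [h, map_zero, mul_zero]
  exact tendsto_const_nhds

/-- `(s + t) e₀ = s e₀ + t e₀`. [folklore] -/
theorem single_time_add (s t : ℝ) :
    EuclideanSpace.single (0 : Fin d) (s + t) = EuclideanSpace.single 0 s + EuclideanSpace.single 0 t :=
  PiLp.single_add 2 0

/-- **Shifting both arguments in time** (E1): for a Euclidean covariant family,
`timeCluster (A(· + r e₀)) (B(· - r e₀)) s = timeCluster A B (s + 2r)`. [folklore] -/
theorem IsEuclideanCovariant.timeCluster_translateMulti (hE1 : S.IsEuclideanCovariant)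
    (A : 𝓢((Fin n → EuclideanSpace ℝ (Fin d)), ℂ)) (B : 𝓢((Fin m → EuclideanSpace ℝ (Fin d)), ℂ))
    (r s : ℝ) :
    S.timeCluster (Literature.MathematicalPhysics.QuantumLattice.translateMulti (EuclideanSpace.single 0 (-r)) A)
        (Literature.MathematicalPhysics.QuantumLattice.translateMulti (EuclideanSpace.single 0 r) B) s =
      S.timeCluster A B (s + 2 * r) := by
  simp only [timeCluster]
  rw [translateMulti_translateMulti, ← hE1.translateMulti (n + m) (EuclideanSpace.single 0 (-r))
    (A.appendTensor _), translateMulti_appendTensor, translateMulti_translateMulti]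
  congr 3
  rw [← single_time_add, ← single_time_add]
  congr 1
  ring

/-- Time clustering is invariant under shifting `A` backward and `B` forward in time (E1). [folklore] -/
theorem IsEuclideanCovariant.timeClusters_of_translateMulti (hE1 : S.IsEuclideanCovariant)
    {A : 𝓢((Fin n → EuclideanSpace ℝ (Fin d)), ℂ)} {B : 𝓢((Fin m → EuclideanSpace ℝ (Fin d)), ℂ)}
    (r : ℝ) (h : S.TimeClusters (Literature.MathematicalPhysics.QuantumLattice.translateMulti (EuclideanSpace.single 0 (-r)) A)
      (Literature.MathematicalPhysics.QuantumLattice.translateMulti (EuclideanSpace.single 0 r) B)) :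
    S.TimeClusters A B := by
  unfold TimeClusters at *
  have hfun : S.timeCluster (Literature.MathematicalPhysics.QuantumLattice.translateMulti (EuclideanSpace.single 0 (-r)) A)
      (Literature.MathematicalPhysics.QuantumLattice.translateMulti (EuclideanSpace.single 0 r) B) = fun s => S.timeCluster A B (s + 2 * r) :=
    funext (hE1.timeCluster_translateMulti A B r)
  rw [hfun, hE1.translateMulti, hE1.translateMulti] at h
  have hT : Tendsto (fun s : ℝ => s + -(2 * r)) atTop atTop :=
    tendsto_atTop_add_const_right _ _ tendsto_id
  have := h.comp hT
  refine this.congr fun s => ?_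
  simp only [Function.comp_apply]
  congr 1
  ring

end SchwingerFamily

variable {μ : Measure (FieldConfig (EuclideanSpace ℝ (Fin d)))}
  {S : SchwingerFamily (EuclideanSpace ℝ (Fin d))}

/-- `osAdjoint` is subtractive. [folklore] -/
theorem osAdjoint_sub (F G : 𝓢((Fin n → EuclideanSpace ℝ (Fin d)), ℂ)) :
    osAdjoint (F - G) = osAdjoint F - osAdjoint G := by
  ext x; simp

/-- **Step 1 (elementary positive-time tensors).** For real positive-time `fᵢ, gⱼ`, the pair
`(Θ(f₁ ⊗ ⋯ ⊗ fₙ)*, g₁ ⊗ ⋯ ⊗ gₘ)` clusters in time: the correlation is the OS form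
`b(δ_f, T_s δ_g)` of `OSPolyCluster`, which converges by Glimm–Jaffe Thm 19.7.1
(`tendsto_polyForm_polyShift`), and the limit `conj (∫ ∏ ω(θfᵢ)) ∫ ∏ ω(gⱼ)` is
`𝔖ₙ(Θf*) 𝔖ₘ(g)`. [cite: GlimmJaffeQP1987, Thm 19.7.1] -/
theorem IsOSMeasure.timeClusters_osAdjoint_tensorFin (hμ : IsOSMeasure d μ)
    (hcont : ∀ n : ℕ, Continuous fun f : Fin n → 𝓢(EuclideanSpace ℝ (Fin d), ℝ) => moment μ n f)
    (hS : IsSchwingerFamilyOf μ S) {f : Fin n → 𝓢(EuclideanSpace ℝ (Fin d), ℝ)}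
    {g : Fin m → 𝓢(EuclideanSpace ℝ (Fin d), ℝ)} (hf : ∀ i, IsPositiveTime (f i))
    (hg : ∀ j, IsPositiveTime (g j)) :
    S.TimeClusters (osAdjoint (SchwartzMap.tensorFin n fun i => ofRealTest (f i)))
      (SchwartzMap.tensorFin m fun j => ofRealTest (g j)) := by
  haveI := hμ.isProbabilityMeasure
  set i : PosMonomial d := ⟨n, fun j => ⟨f j, hf j⟩⟩ with hi
  set k : PosMonomial d := ⟨m, fun j => ⟨g j, hg j⟩⟩ with hk
  set F₀ := SchwartzMap.tensorFin n fun i => ofRealTest (f i) with hF₀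
  set G₀ := SchwartzMap.tensorFin m fun j => ofRealTest (g j) with hG₀
  -- the correlation is the OS form of `OSPolyCluster`
  have key : ∀ s : ℝ, 0 ≤ s → S.timeCluster (osAdjoint F₀) G₀ s =
      polyForm μ (Finsupp.single i 1) (polyShift s (Finsupp.single k 1)) := by
    intro s hs
    have hG : IsTensorOf (translateMulti (EuclideanSpace.single (0 : Fin d) s) G₀)
        fun j => ofRealTest (timeShiftTest d s (g j)) :=
      (isTensorOf_tensorFin _).translateMulti (EuclideanSpace.single 0 s)
    have h1 : S.timeCluster (osAdjoint F₀) G₀ s =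
        S.osPairing F₀ (translateMulti (EuclideanSpace.single (0 : Fin d) s) G₀) := rfl
    rw [h1, hS.osPairing_tensor (isTensorOf_tensorFin _) hG, polyShift, Finsupp.lmapDomain_apply,
      Finsupp.mapDomain_single, polyForm_single_single]
    simp only [shiftMonomial, max_eq_left hs, i, k]
    rfl
  -- the limit of the OS form, identified
  have hlim := tendsto_polyForm_polyShift hμ hcont (Finsupp.single i 1) (Finsupp.single k 1)
  have hB : ∫ ω, polyEval (Finsupp.single k (1 : ℂ)) ω ∂μ = S m G₀ := by
    rw [hS.apply_tensorFin]
    simp only [polyEval_single, one_smul, posMonomialFn, k]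
  have hA : conj (∫ ω, polyEval (Finsupp.single i (1 : ℂ)) (thetaField d ω) ∂μ) =
      S n (osAdjoint F₀) := by
    have hT : IsTensorOf (osAdjoint F₀) fun j => ofRealTest (thetaTest d (f (Fin.rev j))) :=
      (isTensorOf_tensorFin _).osAdjoint
    have hperm : moment μ n (fun j => thetaTest d (f (Fin.rev j))) =
        moment μ n (fun j => thetaTest d (f j)) :=
      moment_comp_perm μ Fin.revPerm (fun j => thetaTest d (f j))
    rw [hS n _ _ hT, hperm, moment, ← integral_complex_ofReal, ← integral_conj]
    refine integral_congr_ae (ae_of_all _ fun ω => ?_)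
    simp only [polyEval_single, one_smul, posMonomialFn, monomialFn, thetaField_apply, i, map_prod,
      Complex.conj_ofReal, Complex.ofReal_prod]
  rw [hB, hA] at hlim
  refine (tendsto_congr' ?_).1 hlim
  filter_upwards [eventually_ge_atTop 0] with s hs
  exact (key s hs).symm

/-- **Step 1' (finite combinations).** Time clustering of `(ΘF₀*, G₀)` for `F₀, G₀` in the spans of
the positive-time tensor products (sesquilinearity). [folklore] -/
theorem IsOSMeasure.timeClusters_osAdjoint_of_mem_span (hμ : IsOSMeasure d μ)
    (hcont : ∀ n : ℕ, Continuous fun f : Fin n → 𝓢(EuclideanSpace ℝ (Fin d), ℝ) => moment μ n f)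
    (hS : IsSchwingerFamilyOf μ S) {F₀ : 𝓢((Fin n → EuclideanSpace ℝ (Fin d)), ℂ)}
    (hF₀ : F₀ ∈ Submodule.span ℂ (positiveTensorProducts (d := d) n))
    {G₀ : 𝓢((Fin m → EuclideanSpace ℝ (Fin d)), ℂ)}
    (hG₀ : G₀ ∈ Submodule.span ℂ (positiveTensorProducts (d := d) m)) :
    S.TimeClusters (osAdjoint F₀) G₀ := by
  refine Submodule.span_induction₂ (p := fun F G _ _ => S.TimeClusters (osAdjoint F) G)
    ?_ ?_ ?_ ?_ ?_ ?_ ?_ hF₀ hG₀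
  · intro F G hF hG
    obtain ⟨f, hf, hFt⟩ := hF
    obtain ⟨g, hg, hGt⟩ := hG
    rw [hFt.unique (isTensorOf_tensorFin _), hGt.unique (isTensorOf_tensorFin _)]
    exact hμ.timeClusters_osAdjoint_tensorFin hcont hS hf hg
  · intro G _
    have h0 : osAdjoint (0 : 𝓢((Fin n → EuclideanSpace ℝ (Fin d)), ℂ)) = 0 := by ext x; simp
    rw [h0]
    exact SchwingerFamily.timeClusters_zero_left G
  · intro F _
    exact SchwingerFamily.timeClusters_zero_right _
  · intro F F' G _ _ _ h h'
    rw [osAdjoint_add]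
    exact h.add_left h'
  · intro F G G' _ _ _ h h'
    exact h.add_right h'
  · intro c F G _ _ h
    rw [osAdjoint_smul]
    exact h.smul_left _
  · intro c F G _ _ h
    exact h.smul_right _

/-- The difference of two correlations, split into two `F* ⊗ G` terms. [folklore] -/
theorem SchwingerFamily.timeCluster_sub_timeCluster (S : SchwingerFamily (EuclideanSpace ℝ (Fin d)))
    (A A' : 𝓢((Fin n → EuclideanSpace ℝ (Fin d)), ℂ)) (B B' : 𝓢((Fin m → EuclideanSpace ℝ (Fin d)), ℂ))
    (s : ℝ) :
    S.timeCluster A' B' s - S.timeCluster A B s =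
      S (n + m) ((A' - A).appendTensor (translateMulti (EuclideanSpace.single 0 s) B')) +
        S (n + m) (A.appendTensor (translateMulti (EuclideanSpace.single 0 s) (B' - B))) := by
  simp only [SchwingerFamily.timeCluster, SchwartzMap.appendTensor_sub_left, map_sub,
    SchwartzMap.appendTensor_sub_right]
  ring

/-- **Uniform control in the time shift**: for the Schwinger family of a measure,
`|timeCluster A' B' s - timeCluster A B s| ≤ N((A'-A)*)^{1/2} N(B')^{1/2} + N(A*)^{1/2} N(B'-B)^{1/2}`
for all `s` (the `L²` bound plus translation invariance of `N`). [folklore] -/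
theorem IsSchwingerFamilyOf.norm_timeCluster_sub_le [IsFiniteMeasure μ] (hS : IsSchwingerFamilyOf μ S)
    (hμ : HasAllMoments μ) (hE1 : S.IsEuclideanCovariant)
    (A A' : 𝓢((Fin n → EuclideanSpace ℝ (Fin d)), ℂ)) (B B' : 𝓢((Fin m → EuclideanSpace ℝ (Fin d)), ℂ))
    (s : ℝ) :
    ‖S.timeCluster A' B' s - S.timeCluster A B s‖ ≤
      √(S.sqNorm n (osStar (A' - A))) * √(S.sqNorm m B') +
        √(S.sqNorm n (osStar A)) * √(S.sqNorm m (B' - B)) := by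
  rw [S.timeCluster_sub_timeCluster]
  refine (norm_add_le _ _).trans (add_le_add ?_ ?_)
  · have h := hS.norm_apply_appendTensor_le hμ (A' - A)
      (translateMulti (EuclideanSpace.single (0 : Fin d) s) B')
    rwa [hE1.sqNorm_translateMulti] at h
  · have h := hS.norm_apply_appendTensor_le hμ A
      (translateMulti (EuclideanSpace.single (0 : Fin d) s) (B' - B))
    rwa [hE1.sqNorm_translateMulti] at h

omit [NeZero d] in
/-- The error bound of `norm_timeCluster_sub_le` tends to zero along `𝒮`-convergent sequences
`A_k → A`, `B_k → B`. [folklore] -/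
theorem SchwingerFamily.tendsto_errorBound (S : SchwingerFamily (EuclideanSpace ℝ (Fin d)))
    {A : 𝓢((Fin n → EuclideanSpace ℝ (Fin d)), ℂ)} {B : 𝓢((Fin m → EuclideanSpace ℝ (Fin d)), ℂ)}
    {Ak : ℕ → 𝓢((Fin n → EuclideanSpace ℝ (Fin d)), ℂ)} {Bk : ℕ → 𝓢((Fin m → EuclideanSpace ℝ (Fin d)), ℂ)}
    (hA : Tendsto Ak atTop (𝓝 A)) (hB : Tendsto Bk atTop (𝓝 B)) :
    Tendsto (fun k => √(S.sqNorm n (osStar (Ak k - A))) * √(S.sqNorm m (Bk k)) +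
      √(S.sqNorm n (osStar A)) * √(S.sqNorm m (Bk k - B))) atTop (𝓝 0) := by
  have hA0 : Tendsto (fun k => Ak k - A) atTop (𝓝 0) := tendsto_sub_nhds_zero_iff.2 hA
  have hB0 : Tendsto (fun k => Bk k - B) atTop (𝓝 0) := tendsto_sub_nhds_zero_iff.2 hB
  have h1 : Tendsto (fun k => √(S.sqNorm n (osStar (Ak k - A)))) atTop (𝓝 0) := by
    have h := ((Real.continuous_sqrt.comp ((S.continuous_sqNorm n).comp continuous_osStar)).tendsto
      (0 : 𝓢((Fin n → EuclideanSpace ℝ (Fin d)), ℂ))).comp hA0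
    simpa [Function.comp_def] using h
  have h2 : Tendsto (fun k => √(S.sqNorm m (Bk k))) atTop (𝓝 (√(S.sqNorm m B))) :=
    ((Real.continuous_sqrt.comp (S.continuous_sqNorm m)).tendsto B).comp hB
  have h3 : Tendsto (fun k => √(S.sqNorm m (Bk k - B))) atTop (𝓝 0) := by
    have h := ((Real.continuous_sqrt.comp (S.continuous_sqNorm m)).tendsto
      (0 : 𝓢((Fin m → EuclideanSpace ℝ (Fin d)), ℂ))).comp hB0
    simpa [Function.comp_def] using h
  have h := (h1.mul h2).add (tendsto_const_nhds (x := √(S.sqNorm n (osStar A))) |>.mul h3)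
  simpa using h

/-- **Step 2 (positive-time test functions).** `(ΘF*, G)` clusters in time for all `F, G`
supported in the open positive-time wedge: approximate by finite combinations of positive-time
tensor products (`IsPositiveTimeMulti.mem_closure_span_positiveTensorProducts_holds`) with the
uniform `L²` control `norm_timeCluster_sub_le`. [cite: OsterwalderSchraderCMP1973, §3 (E4) and §2 p. 87] -/
theorem IsOSMeasure.timeClusters_osAdjoint (hμ : IsOSMeasure d μ)
    (hcont : ∀ n : ℕ, Continuous fun f : Fin n → 𝓢(EuclideanSpace ℝ (Fin d), ℝ) => moment μ n f)
    (hS : IsSchwingerFamilyOf μ S) {F : 𝓢((Fin n → EuclideanSpace ℝ (Fin d)), ℂ)}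
    (hF : IsPositiveTimeMulti F) {G : 𝓢((Fin m → EuclideanSpace ℝ (Fin d)), ℂ)}
    (hG : IsPositiveTimeMulti G) : S.TimeClusters (osAdjoint F) G := by
  haveI := hμ.isProbabilityMeasure
  have hall : HasAllMoments μ := hμ.hasAllMoments
  have hE1 : S.IsEuclideanCovariant :=
    IsSchwingerFamilyOf.isEuclideanCovariant_holds hS hall hμ.os2
  obtain ⟨Fk, hFk_mem, hFk⟩ := mem_closure_iff_seq_limit.1
    (IsPositiveTimeMulti.mem_closure_span_positiveTensorProducts_holds n F hF)
  obtain ⟨Gk, hGk_mem, hGk⟩ := mem_closure_iff_seq_limit.1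
    (IsPositiveTimeMulti.mem_closure_span_positiveTensorProducts_holds m G hG)
  refine tendsto_of_uniform_approx (ck := fun k => S.timeCluster (osAdjoint (Fk k)) (Gk k))
    (ℓk := fun k => S n (osAdjoint (Fk k)) * S m (Gk k))
    (ε := fun k => √(S.sqNorm n (osStar (osAdjoint (Fk k) - osAdjoint F))) * √(S.sqNorm m (Gk k)) +
      √(S.sqNorm n (osStar (osAdjoint F))) * √(S.sqNorm m (Gk k - G)))
    (fun k => hμ.timeClusters_osAdjoint_of_mem_span hcont hS (hFk_mem k) (hGk_mem k))
    (fun k s => hS.norm_timeCluster_sub_le hall hE1 _ _ _ _ s) ?_ ?_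
  · have hA : Tendsto (fun k => osAdjoint (Fk k)) atTop (𝓝 (osAdjoint F)) :=
      (continuous_osAdjoint.tendsto F).comp hFk
    exact S.tendsto_errorBound hA hGk
  · have hA : Tendsto (fun k => S n (osAdjoint (Fk k))) atTop (𝓝 (S n (osAdjoint F))) :=
      ((S n).continuous.tendsto _).comp ((continuous_osAdjoint.tendsto F).comp hFk)
    exact hA.mul (((S m).continuous.tendsto _).comp hGk)

/-- If every point of `supp F` has all time coordinates of absolute value `≤ R < r`, then
`F(· + r e₀)` is supported at negative times and `F(· - r e₀)` at positive times. [folklore] -/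
theorem tsupport_translateMulti_single_neg_subset {F : 𝓢((Fin n → EuclideanSpace ℝ (Fin d)), ℂ)}
    {R r : ℝ} (hR : ∀ x ∈ tsupport (F : (Fin n → EuclideanSpace ℝ (Fin d)) → ℂ), ‖x‖ ≤ R)
    (hr : R < r) :
    tsupport (translateMulti (EuclideanSpace.single (0 : Fin d) (-r)) F :
        (Fin n → EuclideanSpace ℝ (Fin d)) → ℂ) ⊆ {x | ∀ i, x i 0 < 0} := by
  intro x hx i
  have hx' := tsupport_translateMulti_subset _ F hx
  have h1 := hR _ hx'
  have h2 : ‖x i - EuclideanSpace.single (0 : Fin d) (-r)‖ ≤ R :=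
    (norm_le_pi_norm (fun j => x j - EuclideanSpace.single (0 : Fin d) (-r)) i).trans h1
  have h3 : |(x i - EuclideanSpace.single (0 : Fin d) (-r)) 0| ≤ R :=
    (Real.norm_eq_abs _ ▸ PiLp.norm_apply_le (x i - EuclideanSpace.single (0 : Fin d) (-r)) 0).trans h2
  simp only [PiLp.sub_apply, PiLp.single_apply, if_true, sub_neg_eq_add] at h3
  have := (abs_le.1 h3).2
  linarith

/-- Companion of `tsupport_translateMulti_single_neg_subset` for the forward shift. [folklore] -/
theorem isPositiveTimeMulti_translateMulti_single {F : 𝓢((Fin n → EuclideanSpace ℝ (Fin d)), ℂ)}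
    {R r : ℝ} (hR : ∀ x ∈ tsupport (F : (Fin n → EuclideanSpace ℝ (Fin d)) → ℂ), ‖x‖ ≤ R)
    (hr : R < r) :
    IsPositiveTimeMulti (translateMulti (EuclideanSpace.single (0 : Fin d) r) F) := by
  intro x hx i
  have hx' := tsupport_translateMulti_subset _ F hx
  have h1 := hR _ hx'
  have h2 : ‖x i - EuclideanSpace.single (0 : Fin d) r‖ ≤ R :=
    (norm_le_pi_norm (fun j => x j - EuclideanSpace.single (0 : Fin d) r) i).trans h1
  have h3 : |(x i - EuclideanSpace.single (0 : Fin d) r) 0| ≤ R :=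
    (Real.norm_eq_abs _ ▸ PiLp.norm_apply_le (x i - EuclideanSpace.single (0 : Fin d) r) 0).trans h2
  simp only [PiLp.sub_apply, PiLp.single_apply, if_true] at h3
  have := (abs_le.1 h3).1
  linarith

/-- **Step 3a (compactly supported test functions).** `(A, B)` clusters in time when `A` and `B`
have compact support: shift `A` backward and `B` forward in time by a large `r` (E1), so that
`A(· + r e₀) = Θ F*` with `F` positive-time and `B(· - r e₀)` is positive-time, and apply Step 2
(OS 1973, Remark 2 on p. 89: the covariant form (E4') of the cluster property). [cite: OsterwalderSchraderCMP1973, §3 Remark 2 (p. 89)] -/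
theorem IsOSMeasure.timeClusters_of_hasCompactSupport (hμ : IsOSMeasure d μ)
    (hcont : ∀ n : ℕ, Continuous fun f : Fin n → 𝓢(EuclideanSpace ℝ (Fin d), ℝ) => moment μ n f)
    (hS : IsSchwingerFamilyOf μ S) {A : 𝓢((Fin n → EuclideanSpace ℝ (Fin d)), ℂ)}
    (hA : HasCompactSupport (A : (Fin n → EuclideanSpace ℝ (Fin d)) → ℂ))
    {B : 𝓢((Fin m → EuclideanSpace ℝ (Fin d)), ℂ)}
    (hB : HasCompactSupport (B : (Fin m → EuclideanSpace ℝ (Fin d)) → ℂ)) : S.TimeClusters A B := by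
  haveI := hμ.isProbabilityMeasure
  have hall : HasAllMoments μ := hμ.hasAllMoments
  have hE1 : S.IsEuclideanCovariant :=
    IsSchwingerFamilyOf.isEuclideanCovariant_holds hS hall hμ.os2
  obtain ⟨RA, hRA⟩ := isBounded_iff_forall_norm_le.1 hA.isBounded
  obtain ⟨RB, hRB⟩ := isBounded_iff_forall_norm_le.1 hB.isBounded
  set r : ℝ := max RA RB + 1 with hr
  have hrA : RA < r := by rw [hr]; linarith [le_max_left RA RB]
  have hrB : RB < r := by rw [hr]; linarith [le_max_right RA RB]
  refine hE1.timeClusters_of_translateMulti r ?_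
  have hneg := tsupport_translateMulti_single_neg_subset hRA hrA
  have hpos := isPositiveTimeMulti_translateMulti_single hRB hrB
  have h := hμ.timeClusters_osAdjoint hcont hS (isPositiveTimeMulti_osAdjoint hneg) hpos
  rwa [osAdjoint_osAdjoint] at h

/-- **Step 3 (time clustering for all test functions).** For the Schwinger family of an OS measure,
`𝔖ₙ₊ₘ(A ⊗ B(· - s e₀)) → 𝔖ₙ(A) 𝔖ₘ(B)` as `s → +∞` for ALL `A ∈ 𝓢((ℝ^d)ⁿ)`, `B ∈ 𝓢((ℝ^d)ᵐ)`:
compactly supported approximants (`exists_hasCompactSupport_tendsto`) cluster by Step 3a, and the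
error is uniform in `s` by the `L²` bound. (GJ Thm 19.7.1 with the remark that `A ∈ C₀^∞` and a time
translation suffice; OS 1973 §3 Remark 2.) [cite: GlimmJaffeQP1987, Thm 19.7.1] -/
theorem IsOSMeasure.timeClusters (hμ : IsOSMeasure d μ)
    (hcont : ∀ n : ℕ, Continuous fun f : Fin n → 𝓢(EuclideanSpace ℝ (Fin d), ℝ) => moment μ n f)
    (hS : IsSchwingerFamilyOf μ S) (A : 𝓢((Fin n → EuclideanSpace ℝ (Fin d)), ℂ))
    (B : 𝓢((Fin m → EuclideanSpace ℝ (Fin d)), ℂ)) : S.TimeClusters A B := by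
  haveI := hμ.isProbabilityMeasure
  have hall : HasAllMoments μ := hμ.hasAllMoments
  have hE1 : S.IsEuclideanCovariant :=
    IsSchwingerFamilyOf.isEuclideanCovariant_holds hS hall hμ.os2
  obtain ⟨Ak, hAk_cpt, hAk⟩ := exists_hasCompactSupport_tendsto A
  obtain ⟨Bk, hBk_cpt, hBk⟩ := exists_hasCompactSupport_tendsto B
  refine tendsto_of_uniform_approx (ck := fun k => S.timeCluster (Ak k) (Bk k))
    (ℓk := fun k => S n (Ak k) * S m (Bk k))
    (ε := fun k => √(S.sqNorm n (osStar (Ak k - A))) * √(S.sqNorm m (Bk k)) +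
      √(S.sqNorm n (osStar A)) * √(S.sqNorm m (Bk k - B)))
    (fun k => hμ.timeClusters_of_hasCompactSupport hcont hS (hAk_cpt k) (hBk_cpt k))
    (fun k s => hS.norm_timeCluster_sub_le hall hE1 _ _ _ _ s) (S.tendsto_errorBound hAk hBk) ?_
  exact (((S n).continuous.tendsto _).comp hAk).mul (((S m).continuous.tendsto _).comp hBk)

end TimeCluster

/-! ### E. The cluster property E4 (spatial directions, by Euclidean covariance) -/

section E4

variable {d : ℕ} [NeZero d]

/-- `single 0 (t c) = (t c) • e₀` with `e₀ = single 0 1`. [folklore] -/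
theorem single_time_eq_smul (t : ℝ) :
    EuclideanSpace.single (0 : Fin d) t = t • EuclideanSpace.single (0 : Fin d) (1 : ℝ) := by
  ext i
  simp only [PiLp.single_apply, PiLp.smul_apply, smul_eq_mul]
  split_ifs <;> simp

/-- **Discharge of `IsSchwingerFamilyOf.hasClusterProperty`** (E4 for the Schwinger functions of
an OS measure; OS 1973 §3 (E4), via GJ Thm 19.7.1). For a nonzero spatial `a`, let `L ∈ O(d)` be
the reflection exchanging `a/‖a‖` and `e₀` (`Submodule.reflection_sub`); by E1,
`𝔖ₙ₊ₘ(Θf* ⊗ g_{(ta,1)}) = 𝔖ₙ₊ₘ(L·Θf* ⊗ (L·g)(· - t‖a‖ e₀))`, which converges to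
`𝔖ₙ(L·Θf*) 𝔖ₘ(L·g) = 𝔖ₙ(Θf*) 𝔖ₘ(g)` by the time clustering of Step 3 (`IsOSMeasure.timeClusters`).
(The positive-time hypotheses on `f, g` are not needed.) [cite: OsterwalderSchraderCMP1973, §3 (E4) and Remark 2 p. 89] -/
theorem IsSchwingerFamilyOf.hasClusterProperty_holds :
    IsSchwingerFamilyOf.hasClusterProperty (d := d) := by
  intro μ hμ hcont S hS n m F G _ _ a ha0 ha H hH
  haveI := hμ.isProbabilityMeasure
  have hall : HasAllMoments μ := hμ.hasAllMoments
  have hE1 : S.IsEuclideanCovariant :=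
    IsSchwingerFamilyOf.isEuclideanCovariant_holds hS hall hμ.os2
  -- the witness `H t` is the concrete tensor product
  have hHt : ∀ t : ℝ, S (n + m) (H t) =
      S (n + m) ((osAdjoint F).appendTensor (translateMulti (t • a) G)) := by
    intro t
    congr 1
    ext x
    rw [hH t x, SchwartzMap.appendTensor_apply]
  -- the isometry moving `a` to the time axis
  set e₀ : EuclideanSpace ℝ (Fin d) := EuclideanSpace.single 0 1 with he₀
  have hnorm : ‖a‖ = ‖‖a‖ • e₀‖ := by
    rw [norm_smul, norm_norm, he₀, EuclideanSpace.single, PiLp.norm_single, norm_one, mul_one]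
  set L : EuclideanSpace ℝ (Fin d) ≃ₗᵢ[ℝ] EuclideanSpace ℝ (Fin d) :=
    Submodule.reflection (ℝ ∙ (a - ‖a‖ • e₀))ᗮ with hL
  have hLa : L a = ‖a‖ • e₀ := Submodule.reflection_sub hnorm
  have hLta : ∀ t : ℝ, L (t • a) = EuclideanSpace.single 0 (t * ‖a‖) := by
    intro t
    rw [L.map_smul, hLa, smul_smul, he₀, ← single_time_eq_smul]
  set A' := linActMulti L (osAdjoint F) with hA'
  set B' := linActMulti L G with hB'
  have hclust : Tendsto (S.timeCluster A' B') atTop (𝓝 (S n A' * S m B')) :=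
    hμ.timeClusters hcont hS A' B'
  have hkey : ∀ t : ℝ, S (n + m) (H t) = S.timeCluster A' B' (t * ‖a‖) := by
    intro t
    rw [hHt, ← hE1.linActMulti (n + m) L, linActMulti_appendTensor, linActMulti_translateMulti,
      hLta]
    rfl
  have hlim : S n A' * S m B' = S n (osAdjoint F) * S m G := by
    rw [hA', hB', hE1.linActMulti, hE1.linActMulti]
  have hT : Tendsto (fun t : ℝ => t * ‖a‖) atTop atTop :=
    tendsto_id.atTop_mul_const (norm_pos_iff.2 ha)
  rw [hlim] at hclust
  have h := hclust.comp hT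
  have h' : Tendsto (fun t : ℝ => S (n + m) (H t)) atTop (𝓝 (S n (osAdjoint F) * S m G)) := by
    refine h.congr fun t => ?_
    rw [Function.comp_apply, hkey]
  exact tendsto_sub_nhds_zero_iff.2 h'

end E4

end Literature.MathematicalPhysics.QuantumLattice
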